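import Summits.HodgeConjecture.HodgeConjecture.Theorems.F0P3CohClassRoutingCot            -- ★ `RoutesAt` (split clause), `clFinChoice`, `admUnitConstituents`, `cmSplitPacket`, `splitWitness`, V6 frame
import Summits.HodgeConjecture.HodgeConjecture.Theorems.F0P3XiLocalLabelsOfMemXiFamily    -- ★ (LS) `locη_eq_and_locψ_eq_of_mem_cmSplitPacket_members`, `bc_localComponent_eq_…`
import Summits.HodgeConjecture.HodgeConjecture.Theorems.F0P3FinComponentTokens            -- ★ `admUnitConstituents_nonempty_of_hasFinComponent`
import Literature.NumberTheory.Automorphic.UnitaryGroupAutomorphicFlathAdmissible          -- ★ named frame predicate `AutomorphicFlathAdmissible` (RULING (AFA-1): ONE binder `hAF`)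
import HarnessLib

/-!
# R90-TF · S5 «Ch. 13.3 rigidity» — DEAL #15 «(iv-S) SPLIT PLUMBING»: a `P` ROUTED by `ξ` at a split `v` and lying in the `ξ′`-ENVELOPE has
# `ξ`'s and `ξ′`'s split labels `η̃_w, ψ̃_w` EQUAL at the definite witness `w = splitWitness v hs`

Cell `hodgecm-mathlib`, crux H413 (`stmt-HodgeConjecture-24833`), route of record `HCCMUnconditional`; programme R90-TF (brief `director/R90-BRIEF.v2.md`),
section S5 (Ch. 13.3), dealer R90-C133-plan (g0) DEAL #15 (R90 bus 2026-09-04T16:14:29Z (b)) to seat R90-C131-p02 (g0) (free S4 hand placed by LEAD #21);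
ROAD S of (J-a″) «occurrence + a.e.-`πⁿ` ⇒ `MemXiFamily`», split places; consumed BY NAME by R90-C133-p02's assembly `Theorems/R90S5FamilyPinOfSplitCofinite.lean`
(file 3).  PROOF lane: theorems only (no `def`, no instance, no notation, no `sorry`); `--supports stmt-HodgeConjecture-24833 --as helper`; imports ★ Theorems only.

THE MATHEMATICS [Rogawski1990, §13.3 p. 201 (the finite part of `Π′(ξ) = ⊗ Π′(ξ_v)`); §13.1 p. 199 and Lemma 4.13.1 (b) p. 62 (at a split `v` read through `w ∣ v`,
`Π(ξ_v) = {i_G(ξ_w ⊗ μ_w ∘ det₀)}` is a SINGLETON); [Zelevinsky1980, Thm. 4.2 ∕ 6.1], [BernsteinZelevinsky1977, Thm. 2.9] (an irreducible unitary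
`Ind((ν₀ ∘ det) ⊠ χ′)` of `GL₃` determines `(ν₀, χ′)`)].  Let `P` be a discrete automorphic representation of the inner form `U(H)`, `v` a finite place of
`L⁺` SPLIT in `L`, `w = splitWitness v hs` the definite place above it (★ D6 ed. 2).  If
* `P` is ROUTED by `ξ` at `v` (★ `F0P3CohClassRoutingCot.RoutesAt … P ξ v`, split clause: the chosen local class ★ `clFinChoice P v` IS the member `πⁿ` of the split
  packet ★ `cmSplitPacket` of `ξ` at `w`), and
* `P` lies in the `ξ′`-ENVELOPE (★ D6 `MemXiFamily P … ξ′`: some `ξ′`-local family `Pv′` — at `v` necessarily the split packet of `ξ′` at the SAME `w`, ★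
  `IsXiLocalFamily.eq_cmSplitPacket` — contains every finite local constituent of `P`, ★ `LocalConstituentsIn`), and
* `P` HAS an admissible unitarizable constituent at `v` (★ `(admUnitConstituents P v).Nonempty` — automatic under an irreducible admissible finite component,
  ★ `F0P3FinComponentTokens.admUnitConstituents_nonempty_of_hasFinComponent`; then `clFinChoice P v` IS a constituent of `P` at `v`, ★
  `clFinChoice_isConstituentOf_of_nonempty`),
then the one class `clFinChoice P v` lies in BOTH singleton split packets at `w`, so ★ (LS) `F0P3XiLocalLabelsOfMemXiFamily.locη_eq_and_locψ_eq_of_mem_cmSplitPacket_members`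
(packet core: BZ∕Zelevinsky rigidity of `Ind((ν₀ ∘ det) ⊠ χ′)`, cancelling the common unit `μ_w`) gives `η_w(ξ) = η_w(ξ′)` and `ψ_w(ξ) = ψ_w(ξ′)`, equivalently equal local
components at `w` of the base-changed Hecke characters `ξ.bcη, ξ′.bcη` and `ξ.bcψ, ξ′.bcψ`.

CONTENTS (all sorry-free; frame = ★ `F0P3CohClassRoutingCot`'s variable block verbatim):
* §1 `clFinChoice_mem_cmSplitPacket_of_routesAt` — the split clause of `RoutesAt` read as MEMBERSHIP of `clFinChoice P v` in `ξ`'s split packet at `splitWitness v hs`;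
  `clFinChoice_mem_family_of_memXiFamily` — under `MemXiFamily P … ξ′` and `(admUnitConstituents P v).Nonempty`, `clFinChoice P v` lies in `ξ′`'s split packet at the same `w`.
* §2 HEADS **`locη_eq_and_locψ_eq_of_routesAt_of_memXiFamily`** (labels) and **`bc_localComponent_eq_of_routesAt_of_memXiFamily`** (local components of `η̃, ψ̃`),
  hypothesis `hne : (admUnitConstituents P v).Nonempty`;
* §3 the same two heads under an irreducible ADMISSIBLE finite component `σ` of `P` (`…_of_hasFinComponent`: `hirr hadm hP` replace `hne`), and under
  the frame's ONE named binder `hAF : AutomorphicFlathAdmissible …` (dealer RULING (AFA-1) 2026-09-04T16:22:56Z: `…_of_automorphicFlathAdmissible`).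
HONEST LABEL: plumbing over ★ theorems only — nothing printed is newly proved; REL ≠ ★ ≠ BUILT; HC_CM is proved only modulo the 7 printed citations (2 remaining named
inputs: hLiu418 = stmt-HodgeConjecture-24832, h413 = stmt-HodgeConjecture-24833) until rung 0 closes.

## References
* [Rogawski1990] J. D. Rogawski, *Automorphic Representations of Unitary Groups in Three Variables*, Ann. of Math. Stud. 123 (1990): §4.13 p. 62, Lemma 4.13.1 (b);
  §13.1 p. 199; §13.3 p. 201; §14.6 Thm. 14.6.4 p. 246; §15.3 ¶1 p. 244.
* [Zelevinsky1980] A. V. Zelevinsky, *Induced representations of reductive 𝔭-adic groups II*, Ann. Sci. ÉNS 13 (1980): Thm. 4.2, Thm. 6.1.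
* [BernsteinZelevinsky1977] I. N. Bernstein, A. V. Zelevinsky, *Induced representations of reductive 𝔭-adic groups I*, Ann. Sci. ÉNS 10 (1977): Thm. 2.9.
* [FlathCorvallis1979] D. Flath, *Decomposition of representations into tensor products*, PSPM 33.1 (1979), Thm. 3.
-/

set_option autoImplicit false
-- the mandated namespace repeats the single-problem summit's segment (`HodgeConjecture.HodgeConjecture`)
set_option linter.dupNamespace false

noncomputable section

open NumberField IsDedekindDomain MeasureTheory
open Literature.NumberTheory.Rogawski1990 Literature.NumberTheory.GaloisRepresentations
open Literature.NumberTheory.Automorphic Literature.NumberTheory.Automorphic.UnitaryGroup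
open scoped Matrix

namespace Summit.HodgeConjecture.HodgeConjecture.R90.S5

open Summit.HodgeConjecture.HodgeConjecture.Cruxes.H413
open Summit.HodgeConjecture.HodgeConjecture.Cruxes.H413.F0P3InnerFormClassificationV6
open Summit.HodgeConjecture.HodgeConjecture.Cruxes.H413.F0P3ClassTokenChoice (clFinChoice admUnitConstituents clFinChoice_isConstituentOf_of_nonempty)
open Summit.HodgeConjecture.HodgeConjecture.Cruxes.H413.F0P3CohClassRoutingCot (RoutesAt)
open Summit.HodgeConjecture.HodgeConjecture.Cruxes.H413.F0P3XiLocalLabelsOfMemXiFamily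
  (locη_eq_and_locψ_eq_of_mem_cmSplitPacket_members bc_localComponent_eq_of_mem_cmSplitPacket_members)
open Summit.HodgeConjecture.HodgeConjecture.Cruxes.H413.F0P3FinComponentTokens (admUnitConstituents_nonempty_of_hasFinComponent)

variable (L : Type) [Field L] [NumberField L] [IsCMField L] (H : Matrix (Fin 3) (Fin 3) L)
  (hH : (H.map (cmConjRingHom L))ᵀ = H) (hHd : IsUnit H.det) (μω : HeckeCharacter L) (hμu : μω.IsUnitary)
  [∀ v : HeightOneSpectrum (𝓞 ↥(maximalRealSubfield L)), MeasurableSpace (Gqs L v ⧸ Subgroup.center (Gqs L v))]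
  (μZ : ∀ v : HeightOneSpectrum (𝓞 ↥(maximalRealSubfield L)), Measure (Gqs L v ⧸ Subgroup.center (Gqs L v)))
  (keys : ∀ (ξ : OneDimAutRepH L) (v : HeightOneSpectrum (𝓞 ↥(maximalRealSubfield L))),
    (∀ w : PlacesOver L v, IsCMField.complexConj L • w.1 = w.1) →
      {p : IrrClass (Gqs L v) × IrrClass (Gqs L v) //
        KeysCaseTwoLabels L v (μω.semilocalComponent L v) (torusLocalComponent L (IsCMField.complexConj L) v ξ.η)
          (torusLocalComponent L (IsCMField.complexConj L) v ξ.ψ) p.1 p.2 ∧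
        p.1.IsSquareIntegrable (μZ v) ∧ ¬ p.2.IsSquareIntegrable (μZ v)})
  (μ : Measure (Gp L H).automorphicQuotient) [(Gp L H).IsAutomorphicMeasure μ]

/-! ## §1 Memberships of the chosen class `clFinChoice P v` at a split place -/

/-- **The split clause of `RoutesAt` as a membership**: if `P` is routed by `ξ` at the split place `v`, its chosen local class ★ `clFinChoice P v` lies in
the split packet of `ξ` at the definite witness `w = splitWitness v hs` (that packet is the singleton `{πⁿ}`, ★ `cmSplitPacket_πn_mem`).
[cite: Rogawski1990, §13.1 p. 199; §15.3 ¶1 p. 244] -/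
theorem clFinChoice_mem_cmSplitPacket_of_routesAt (P : DiscreteAutomorphicRep (Gp L H) μ) (ξ : OneDimAutRepH L)
    (v : HeightOneSpectrum (𝓞 ↥(maximalRealSubfield L))) (hs : ∃ w : PlacesOver L v, IsCMField.complexConj L • w.1 ≠ w.1)
    (hroute : RoutesAt L H hH hHd μω hμu μZ keys μ P ξ v) :
    clFinChoice P v ∈
      (cmSplitPacket L H hH hHd v (splitWitness v hs) (splitWitness_spec v hs) (ξ.splitν₀ μω (splitWitness v hs).1)
        (ξ.locψ (splitWitness v hs).1) (ξ.norm_splitν₀_apply hμu (splitWitness v hs).1)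
        (ξ.continuous_splitν₀ μω (splitWitness v hs).1) (ξ.norm_locψ_apply (splitWitness v hs).1)
        (ξ.continuous_locψ (splitWitness v hs).1)).members := by
  rw [hroute.1 hs]
  exact cmSplitPacket_πn_mem L H hH hHd v (splitWitness v hs) (splitWitness_spec v hs) _ _ _ _ _ _

omit [∀ v : HeightOneSpectrum (𝓞 ↥(maximalRealSubfield L)), MeasurableSpace (Gqs L v ⧸ Subgroup.center (Gqs L v))] in
/-- **Envelope membership read at a split place**: if `P` lies in the `ξ′`-envelope (★ `MemXiFamily`) and has an admissible unitarizable constituent at `v`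
(so that `clFinChoice P v` IS a constituent of `P` at `v`, ★ `clFinChoice_isConstituentOf_of_nonempty`), then `clFinChoice P v` lies in the split packet of `ξ′` at
`w = splitWitness v hs` — the `ξ′`-local family is that packet at `v` (★ `IsXiLocalFamily.eq_cmSplitPacket`) and contains the local constituents of `P`
(★ `LocalConstituentsIn`). [cite: Rogawski1990, §13.3 p. 201; §14.6 p. 246] [cite: FlathCorvallis1979, Thm. 3] -/
theorem clFinChoice_mem_family_of_memXiFamily (P : DiscreteAutomorphicRep (Gp L H) μ) (ξ' : OneDimAutRepH L)
    (v : HeightOneSpectrum (𝓞 ↥(maximalRealSubfield L))) (hs : ∃ w : PlacesOver L v, IsCMField.complexConj L • w.1 ≠ w.1)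
    (hmem : MemXiFamily P hH hHd μω hμu ξ') (hne : (admUnitConstituents P v).Nonempty) :
    clFinChoice P v ∈
      (cmSplitPacket L H hH hHd v (splitWitness v hs) (splitWitness_spec v hs) (ξ'.splitν₀ μω (splitWitness v hs).1)
        (ξ'.locψ (splitWitness v hs).1) (ξ'.norm_splitν₀_apply hμu (splitWitness v hs).1)
        (ξ'.continuous_splitν₀ μω (splitWitness v hs).1) (ξ'.norm_locψ_apply (splitWitness v hs).1)
        (ξ'.continuous_locψ (splitWitness v hs).1)).members := by
  obtain ⟨Pv', hPv', hcst⟩ := hmem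
  rw [← hPv'.eq_cmSplitPacket v hs]
  exact hcst v (clFinChoice P v) (clFinChoice_isConstituentOf_of_nonempty P v hne)

/-! ## §2 HEADS — equal split labels of `ξ` and `ξ′` at the definite witness -/

/-- **(iv-S) SPLIT PLUMBING, labels.**  At a finite place `v` of `L⁺` split in `L`: if `P` is ROUTED by `ξ` at `v` (★ `RoutesAt`), lies in the `ξ′`-ENVELOPE
(★ `MemXiFamily`), and has an admissible unitarizable constituent at `v` (★ `(admUnitConstituents P v).Nonempty`), then `ξ` and `ξ′` have the SAME split labels at
`w = splitWitness v hs`: `η_w(ξ) = η_w(ξ′)` and `ψ_w(ξ) = ψ_w(ξ′)` — the chosen class `clFinChoice P v` lies in both singleton split packets at `w` (§1), and an irreducible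
unitary `Ind((ν₀ ∘ det) ⊠ χ′)` of `GL₃(L_w)` determines `(ν₀, χ′)` (★ (LS) `locη_eq_and_locψ_eq_of_mem_cmSplitPacket_members`).
[cite: Rogawski1990, §4.13 Lemma 4.13.1 (b) p. 62; §13.1 p. 199; §13.3 p. 201] [cite: Zelevinsky1980, Thm. 4.2 and Thm. 6.1] [cite: BernsteinZelevinsky1977, Thm. 2.9] -/
theorem locη_eq_and_locψ_eq_of_routesAt_of_memXiFamily (P : DiscreteAutomorphicRep (Gp L H) μ) (ξ ξ' : OneDimAutRepH L)
    (v : HeightOneSpectrum (𝓞 ↥(maximalRealSubfield L))) (hs : ∃ w : PlacesOver L v, IsCMField.complexConj L • w.1 ≠ w.1)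
    (hroute : RoutesAt L H hH hHd μω hμu μZ keys μ P ξ v) (hmem : MemXiFamily P hH hHd μω hμu ξ')
    (hne : (admUnitConstituents P v).Nonempty) :
    ξ.locη (splitWitness v hs).1 = ξ'.locη (splitWitness v hs).1 ∧ ξ.locψ (splitWitness v hs).1 = ξ'.locψ (splitWitness v hs).1 :=
  locη_eq_and_locψ_eq_of_mem_cmSplitPacket_members hH hHd (splitWitness v hs) (splitWitness_spec v hs) ξ ξ' μω hμu
    (clFinChoice_mem_cmSplitPacket_of_routesAt L H hH hHd μω hμu μZ keys μ P ξ v hs hroute)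
    (clFinChoice_mem_family_of_memXiFamily L H hH hHd μω hμu μ P ξ' v hs hmem hne)

/-- **(iv-S) SPLIT PLUMBING, base-changed Hecke characters.**  Same hypotheses: the Hecke characters `ξ.bcη, ξ′.bcη` (resp. `ξ.bcψ, ξ′.bcψ`) of `L` have the
SAME local component at `w = splitWitness v hs` (★ (LS) `bc_localComponent_eq_of_mem_cmSplitPacket_members`; `ξ.locη w = (ξ.bcη.localComponent w)⁻¹`).
[cite: Rogawski1990, §4.13 p. 62 and Lemma 4.13.1 (b); §13.3 p. 201; §14.6 Thm. 14.6.4 p. 246] [cite: Zelevinsky1980, Thm. 4.2 and Thm. 6.1] -/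
theorem bc_localComponent_eq_of_routesAt_of_memXiFamily (P : DiscreteAutomorphicRep (Gp L H) μ) (ξ ξ' : OneDimAutRepH L)
    (v : HeightOneSpectrum (𝓞 ↥(maximalRealSubfield L))) (hs : ∃ w : PlacesOver L v, IsCMField.complexConj L • w.1 ≠ w.1)
    (hroute : RoutesAt L H hH hHd μω hμu μZ keys μ P ξ v) (hmem : MemXiFamily P hH hHd μω hμu ξ')
    (hne : (admUnitConstituents P v).Nonempty) :
    ξ.bcη.localComponent (splitWitness v hs).1 = ξ'.bcη.localComponent (splitWitness v hs).1 ∧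
      ξ.bcψ.localComponent (splitWitness v hs).1 = ξ'.bcψ.localComponent (splitWitness v hs).1 :=
  bc_localComponent_eq_of_mem_cmSplitPacket_members hH hHd (splitWitness v hs) (splitWitness_spec v hs) ξ ξ' μω hμu
    (clFinChoice_mem_cmSplitPacket_of_routesAt L H hH hHd μω hμu μZ keys μ P ξ v hs hroute)
    (clFinChoice_mem_family_of_memXiFamily L H hH hHd μω hμu μ P ξ' v hs hmem hne)

/-! ## §3 The same heads under an irreducible ADMISSIBLE finite component of `P` -/

/-- **(iv-S), labels, for `P` with an irreducible admissible finite component `σ`** (★ `HasFinComponent`): then `P` has an admissible unitarizable constituent at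
every finite `v` (★ `admUnitConstituents_nonempty_of_hasFinComponent`), and §2 applies: `η_w(ξ) = η_w(ξ′)`, `ψ_w(ξ) = ψ_w(ξ′)` at `w = splitWitness v hs`.
[cite: Rogawski1990, §13.3 p. 201; §14.5 p. 237] [cite: FlathCorvallis1979, Thm. 3] [cite: Zelevinsky1980, Thm. 4.2 and Thm. 6.1] -/
theorem locη_eq_and_locψ_eq_of_routesAt_of_memXiFamily_of_hasFinComponent (P : DiscreteAutomorphicRep (Gp L H) μ)
    {W : Type} [AddCommGroup W] [Module ℂ W] {σ : Representation ℂ (finAdelic (↥(maximalRealSubfield L)) L (IsCMField.complexConj L) 3 H) W}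
    (hirr : σ.IsIrreducible) (hadm : σ.IsAdmissible) (hP : P.HasFinComponent σ) (ξ ξ' : OneDimAutRepH L)
    (v : HeightOneSpectrum (𝓞 ↥(maximalRealSubfield L))) (hs : ∃ w : PlacesOver L v, IsCMField.complexConj L • w.1 ≠ w.1)
    (hroute : RoutesAt L H hH hHd μω hμu μZ keys μ P ξ v) (hmem : MemXiFamily P hH hHd μω hμu ξ') :
    ξ.locη (splitWitness v hs).1 = ξ'.locη (splitWitness v hs).1 ∧ ξ.locψ (splitWitness v hs).1 = ξ'.locψ (splitWitness v hs).1 :=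
  locη_eq_and_locψ_eq_of_routesAt_of_memXiFamily L H hH hHd μω hμu μZ keys μ P ξ ξ' v hs hroute hmem
    (admUnitConstituents_nonempty_of_hasFinComponent L H P hirr hadm hP v)

/-- **(iv-S), base-changed Hecke characters, for `P` with an irreducible admissible finite component `σ`.**
[cite: Rogawski1990, §4.13 p. 62; §13.3 p. 201; §14.6 Thm. 14.6.4 p. 246] [cite: FlathCorvallis1979, Thm. 3] [cite: Zelevinsky1980, Thm. 4.2 and Thm. 6.1] -/
theorem bc_localComponent_eq_of_routesAt_of_memXiFamily_of_hasFinComponent (P : DiscreteAutomorphicRep (Gp L H) μ)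
    {W : Type} [AddCommGroup W] [Module ℂ W] {σ : Representation ℂ (finAdelic (↥(maximalRealSubfield L)) L (IsCMField.complexConj L) 3 H) W}
    (hirr : σ.IsIrreducible) (hadm : σ.IsAdmissible) (hP : P.HasFinComponent σ) (ξ ξ' : OneDimAutRepH L)
    (v : HeightOneSpectrum (𝓞 ↥(maximalRealSubfield L))) (hs : ∃ w : PlacesOver L v, IsCMField.complexConj L • w.1 ≠ w.1)
    (hroute : RoutesAt L H hH hHd μω hμu μZ keys μ P ξ v) (hmem : MemXiFamily P hH hHd μω hμu ξ') :
    ξ.bcη.localComponent (splitWitness v hs).1 = ξ'.bcη.localComponent (splitWitness v hs).1 ∧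
      ξ.bcψ.localComponent (splitWitness v hs).1 = ξ'.bcψ.localComponent (splitWitness v hs).1 :=
  bc_localComponent_eq_of_routesAt_of_memXiFamily L H hH hHd μω hμu μZ keys μ P ξ ξ' v hs hroute hmem
    (admUnitConstituents_nonempty_of_hasFinComponent L H P hirr hadm hP v)

/-- **(iv-S), labels, under the frame's ONE binder `hAF : AutomorphicFlathAdmissible …`** (★ named frame predicate: every discrete `P` has an irreducible admissible
finite component — dealer RULING (AFA-1)). [cite: FlathCorvallis1979, Thm. 3 and Thm. 4] [cite: Rogawski1990, §13.3 p. 201] [cite: Zelevinsky1980, Thm. 4.2 and Thm. 6.1] -/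
theorem locη_eq_and_locψ_eq_of_routesAt_of_memXiFamily_of_automorphicFlathAdmissible
    (hAF : UnitaryGroup.AutomorphicFlathAdmissible (↥(maximalRealSubfield L)) L (IsCMField.complexConj L) 3 H μ)
    (P : DiscreteAutomorphicRep (Gp L H) μ) (ξ ξ' : OneDimAutRepH L)
    (v : HeightOneSpectrum (𝓞 ↥(maximalRealSubfield L))) (hs : ∃ w : PlacesOver L v, IsCMField.complexConj L • w.1 ≠ w.1)
    (hroute : RoutesAt L H hH hHd μω hμu μZ keys μ P ξ v) (hmem : MemXiFamily P hH hHd μω hμu ξ') :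
    ξ.locη (splitWitness v hs).1 = ξ'.locη (splitWitness v hs).1 ∧ ξ.locψ (splitWitness v hs).1 = ξ'.locψ (splitWitness v hs).1 := by
  obtain ⟨W, _, _, σ, hirr, hadm, hP⟩ := hAF P
  exact locη_eq_and_locψ_eq_of_routesAt_of_memXiFamily_of_hasFinComponent L H hH hHd μω hμu μZ keys μ P hirr hadm hP ξ ξ' v hs
    hroute hmem

/-- **(iv-S), base-changed Hecke characters, under `hAF : AutomorphicFlathAdmissible …`** (RULING (AFA-1)).
[cite: FlathCorvallis1979, Thm. 3 and Thm. 4] [cite: Rogawski1990, §4.13 p. 62; §13.3 p. 201] [cite: Zelevinsky1980, Thm. 4.2 and Thm. 6.1] -/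
theorem bc_localComponent_eq_of_routesAt_of_memXiFamily_of_automorphicFlathAdmissible
    (hAF : UnitaryGroup.AutomorphicFlathAdmissible (↥(maximalRealSubfield L)) L (IsCMField.complexConj L) 3 H μ)
    (P : DiscreteAutomorphicRep (Gp L H) μ) (ξ ξ' : OneDimAutRepH L)
    (v : HeightOneSpectrum (𝓞 ↥(maximalRealSubfield L))) (hs : ∃ w : PlacesOver L v, IsCMField.complexConj L • w.1 ≠ w.1)
    (hroute : RoutesAt L H hH hHd μω hμu μZ keys μ P ξ v) (hmem : MemXiFamily P hH hHd μω hμu ξ') :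
    ξ.bcη.localComponent (splitWitness v hs).1 = ξ'.bcη.localComponent (splitWitness v hs).1 ∧
      ξ.bcψ.localComponent (splitWitness v hs).1 = ξ'.bcψ.localComponent (splitWitness v hs).1 := by
  obtain ⟨W, _, _, σ, hirr, hadm, hP⟩ := hAF P
  exact bc_localComponent_eq_of_routesAt_of_memXiFamily_of_hasFinComponent L H hH hHd μω hμu μZ keys μ P hirr hadm hP ξ ξ' v hs
    hroute hmem

end Summit.HodgeConjecture.HodgeConjecture.R90.S5

end
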